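import Summits.BirchSwinnertonDyer.BirchSwinnertonDyer.Theses.BiquadraticEisensteinDescent
import Summits.BirchSwinnertonDyer.BirchSwinnertonDyer.Theorems.BiquadraticEisensteinDescentEisensteinHeartFlatCMInertBadKPrimeHsiehWitness
import HarnessLib

/-!
# GlueCheck «thread-A» (lead bsd-wall-cm-bed-p1 g0, 2026-08-28): thread `HsiehAnyLevelInput →` in front of the ♭-heart
# 21341 and its parent 20710 (as Thm B already fronts the parent) — OPTIONAL pen edit; kernel certificates only

Nothing here is proposed to the tree. `HeartA` / `ParentA` are the two restated texts (threadA/*.sig, byte-for-byte);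
`glueA` is the new parent glue; `closesA` shows the route's `closes` consumes `ParentA` with its own binder h8;
`heartA_of_div` shows that after the edit the line `hsieh-lambda` has ONE stub (`stub_divHsiehWitness`): its
composition is `stub_hsiehWitness_of_thmA` (p594900 ✓) + the input + ideal rigidity.
-/

set_option linter.dupNamespace false
set_option autoImplicit false

noncomputable section

open scoped Classical NumberField

open WeierstrassCurve NumberField IsDedekindDomain Field PowerSeries
  Literature.NumberTheory.EllipticCurves Literature.NumberTheory.EllipticCurves.ModularForms
  Literature.NumberTheory.EllipticCurves.Rank1Residual
  Literature.NumberTheory.EllipticCurves.Hsieh2014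
  Literature.NumberTheory.GaloisRepresentations
  Summit.BirchSwinnertonDyer.Rank1Residual Summit.BirchSwinnertonDyer.Rank1Residual.X11b
  Summit.BirchSwinnertonDyer.Rank1Residual.X11b.AcSelmer

namespace Summit.BirchSwinnertonDyer.BirchSwinnertonDyer.Cruxes.EisensteinHeartFlatCMInertBadKPrime.ThreadA

open Summit.BirchSwinnertonDyer.BirchSwinnertonDyer.Theses.BiquadraticEisensteinDescent

/-- Proposed text of 21341 after the edit (threadA/EisensteinHeartFlatCMInertBadKPrimeA.sig). -/
def HeartA : Prop :=
  Literature.NumberTheory.EllipticCurves.Hsieh2014.thmA_exists_isHsiehLFunction_unrPeriod_anyLevel → ∀ (W : WeierstrassCurve ℚ) [W.IsElliptic] [W.IsGloballyMinimal] (p : ℕ) [Fact p.Prime] [NeZero (W.conductorNorm ℤ)] (K : Type) [Field K] [NumberField K], W.HasCM → W.analyticRank = 1 → 5 ≤ p → Literature.NumberTheory.EllipticCurves.Rank1Residual.CMInert W p → ¬ Literature.NumberTheory.EllipticCurves.Rank1Residual.Good W p → Literature.NumberTheory.EllipticCurves.IsImaginaryQuadratic K → Literature.NumberTheory.EllipticCurves.SatisfiesHeegnerHypothesis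 (W.conductorNorm ℤ) K → 4 < (NumberField.discr K).natAbs → ¬ p ∣ NumberField.classNumber K → (W.quadraticTwist (NumberField.discr K : ℚ)).entireLFunction 1 ≠ 0 → ∀ (κ : Literature.NumberTheory.EllipticCurves.ZpExtension K p), κ.IsAnticyclotomic → ∀ (γ : Field.absoluteGaloisGroup K) [Fact (κ.IsTopGenerator γ)] (𝔭 : IsDedekindDomain.HeightOneSpectrum (NumberField.RingOfIntegers K)), ((p : ℕ) : NumberField.RingOfIntegers K) ∈ 𝔭.asIdeal → 𝔭.asIdeal.ramificationIdx (NumberField.RingOfIntegers ℚ) = 1 → 𝔭.asIdeal.inertiaDeg (NumberField.RingOfIntegers ℚ) = 1 → ∀ (f : CuspForm (CongruenceSubgroup.Gamma0 (W.conductorNorm ℤ)) 2), Literature.NumberTheory.EllipticCurves.ModularForms.IsNewformOf W f → ∀ (ι' : PadicAlgCl p ≃+* ℂ), (∀ (w : NumberField.InfinitePlace K) (k : NumberField.RingOfIntegers K), k ∈ 𝔭.asIdeal ↔ ‖ι'.symm (w.embedding (k : K))‖ < 1) → ∀ (ΩK : ℂ) (Ωp : (Literature.NumberTheory.EllipticCurves.unrIntegers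 p)ˣ) (Q : PowerSeries (PadicComplexInt p)), ΩK ≠ 0 → Summit.BirchSwinnertonDyer.Rank1Residual.X11b.R1.IsBDPLFunctionInt p ι' 𝔭 κ γ f ΩK ((Ωp : Literature.NumberTheory.EllipticCurves.unrIntegers p) : (PadicComplex p)) Q → ∀ (𝔭' : IsDedekindDomain.HeightOneSpectrum (NumberField.RingOfIntegers K)), ((p : ℕ) : NumberField.RingOfIntegers K) ∈ 𝔭'.asIdeal → 𝔭' ≠ 𝔭 → Module.IsTorsion (Literature.NumberTheory.EllipticCurves.IwasawaAlgebra p) (Summit.BirchSwinnertonDyer.Rank1Residual.X11b.AcSelmer.XAc (W.baseChange K) p κ 𝔭' ∅ γ) → ∃ m : ℕ, ∀ x ∈ (Summit.BirchSwinnertonDyer.Rank1Residual.X11b.AcSelmer.XAc.charIdeal (W.baseChange K) p κ 𝔭' ∅ γ).map (PowerSeries.map (Summit.BirchSwinnertonDyer.Rank1Residual.X11b.R1.toCpInt p)), (PowerSeries.C ((p : ℕ) : PadicComplexInt p) : PowerSeries (PadicComplexInt p)) ^ m * x ∈ Ideal.span {Q}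

/-- Proposed text of 20710 after the edit (threadA/EisensteinDivisibilityCMInertBadFlatAtOneKPrimeA.sig). -/
def ParentA : Prop :=
  Literature.NumberTheory.EllipticCurves.Hsieh2014.thmA_exists_isHsiehLFunction_unrPeriod_anyLevel → Literature.NumberTheory.EllipticCurves.Hsieh2014.thmB_exists_isHsiehLFunction_coeff_norm_eq_one_unrPeriod_anyLevel → ∀ (W : WeierstrassCurve ℚ) [W.IsElliptic] [W.IsGloballyMinimal] (p : ℕ) [Fact p.Prime] [NeZero (W.conductorNorm ℤ)] (K : Type) [Field K] [NumberField K], W.HasCM → W.analyticRank = 1 → 5 ≤ p → Literature.NumberTheory.EllipticCurves.Rank1Residual.CMInert W p → ¬ Literature.NumberTheory.EllipticCurves.Rank1Residual.Good W p → Literature.NumberTheory.EllipticCurves.IsImaginaryQuadratic K → Literature.NumberTheory.EllipticCurves.SatisfiesHeegnerHypothesis (W.conductorNorm ℤ) K → 4 < (NumberField.discr K).natAbs → ¬ p ∣ NumberField.classNumber K → (W.quadraticTwist (NumberField.discr K : ℚ)).entireLFunction 1 ≠ 0 → ∀ (κ : Literature.NumberTheory.EllipticCurves.ZpExtension K p),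 κ.IsAnticyclotomic → ∀ (γ : Field.absoluteGaloisGroup K) [Fact (κ.IsTopGenerator γ)] (𝔭 : IsDedekindDomain.HeightOneSpectrum (NumberField.RingOfIntegers K)), ((p : ℕ) : NumberField.RingOfIntegers K) ∈ 𝔭.asIdeal → 𝔭.asIdeal.ramificationIdx (NumberField.RingOfIntegers ℚ) = 1 → 𝔭.asIdeal.inertiaDeg (NumberField.RingOfIntegers ℚ) = 1 → ∀ (𝔭' : IsDedekindDomain.HeightOneSpectrum (NumberField.RingOfIntegers K)), ((p : ℕ) : NumberField.RingOfIntegers K) ∈ 𝔭'.asIdeal → 𝔭' ≠ 𝔭 → Module.IsTorsion (Literature.NumberTheory.EllipticCurves.IwasawaAlgebra p) (Summit.BirchSwinnertonDyer.Rank1Residual.X11b.AcSelmer.XAc (W.baseChange K) p κ 𝔭' ∅ γ) → ∀ (f : CuspForm (CongruenceSubgroup.Gamma0 (W.conductorNorm ℤ)) 2), Literature.NumberTheory.EllipticCurves.ModularForms.IsNewformOf W f → ∀ (ι' : PadicAlgCl p ≃+* ℂ), (∀ (w : NumberField.InfinitePlace K) (k : NumberField.RingOfIntegers K), k ∈ 𝔭.asIdeal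 ↔ ‖ι'.symm (w.embedding (k : K))‖ < 1) → ∀ (ΩK : ℂ) (Ωp : (Literature.NumberTheory.EllipticCurves.unrIntegers p)ˣ) (Q : PowerSeries (PadicComplexInt p)), ΩK ≠ 0 → Summit.BirchSwinnertonDyer.Rank1Residual.X11b.R1.IsBDPLFunctionInt p ι' 𝔭 κ γ f ΩK ((Ωp : Literature.NumberTheory.EllipticCurves.unrIntegers p) : (PadicComplex p)) Q → (Summit.BirchSwinnertonDyer.Rank1Residual.X11b.AcSelmer.XAc.charIdeal (W.baseChange K) p κ 𝔭' ∅ γ).map ((Summit.BirchSwinnertonDyer.Rank1Residual.X11b.R1.toCpInt p).comp (PowerSeries.constantCoeff : Literature.NumberTheory.EllipticCurves.IwasawaAlgebra p →+* ℤ_[p])) ≤ Ideal.span {PowerSeries.constantCoeff Q}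

/-- `HeartA` is literally `HsiehAnyLevelInput → EisensteinHeartFlatCMInertBadKPrime`. -/
theorem heartA_iff : HeartA ↔ (HsiehAnyLevelInput → EisensteinHeartFlatCMInertBadKPrime) := Iff.rfl

/-- `ParentA` is literally `HsiehAnyLevelInput → EisensteinDivisibilityCMInertBadFlatAtOneKPrime`. -/
theorem parentA_iff : ParentA ↔ (HsiehAnyLevelInput → EisensteinDivisibilityCMInertBadFlatAtOneKPrime) := Iff.rfl

/-- NEW GLUE for the parent split: `HeartA → AbsIrrModPBaseChangeCMInert → ParentA` (the landed
`ofPrintFlatK_of_heartFlatK_of_absIrr` under the extra binder). -/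
theorem glueA : HeartA → AbsIrrModPBaseChangeCMInert → ParentA :=
  fun h hI hA => EisensteinDivisibilityCMInertBadFlatAtOneKPrimeGlueBy_holds (h hA) hI

/-- The route's `closes` consumes `ParentA` through its OWN binder h8 (`HsiehAnyLevelInput`): one token. -/
theorem closesA (h1 : ParentA) (h2 : KatzWaldspurgerFrameCMInertBadFlatKPrimeOfLZZ) (h4 : InertBadAtThree)
    (h5 : ManinDatumFiveSevenCMInert) (h6 : PublishedInputsBiquadratic) (h7 : HeegnerFieldSupplyCMInertBadKPrime)
    (h8 : HsiehAnyLevelInput) (h9 : HsiehMuInvariantInput) (h10 : LiuZhangZhangAdditiveInput) :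
    Summit.BirchSwinnertonDyer.WAllCornerFInertBad :=
  closes (h1 h8) h2 h4 h5 h6 h7 h8 h9 h10

/-- After the edit the line `hsieh-lambda` has ONE stub: `HeartA` from the registered `stub_divHsiehWitness`
signature ALONE (the witness comes from `stub_hsiehWitness_of_thmA`, p594900 ✓). -/
theorem heartA_of_div
    (hdiv : ∀ (W : WeierstrassCurve ℚ) [W.IsElliptic] [W.IsGloballyMinimal] (p : ℕ) [Fact p.Prime]
      [NeZero (W.conductorNorm ℤ)] (K : Type) [Field K] [NumberField K],
      W.HasCM → 5 ≤ p → CMInert W p → ¬ Good W p →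
      IsImaginaryQuadratic K → SatisfiesHeegnerHypothesis (W.conductorNorm ℤ) K →
      4 < (NumberField.discr K).natAbs → ¬ p ∣ NumberField.classNumber K →
      ∀ (κ : ZpExtension K p), κ.IsAnticyclotomic →
        ∀ (γ : Field.absoluteGaloisGroup K) [Fact (κ.IsTopGenerator γ)]
          (𝔭 : HeightOneSpectrum (𝓞 K)), ((p : ℕ) : 𝓞 K) ∈ 𝔭.asIdeal →
          𝔭.asIdeal.ramificationIdx (𝓞 ℚ) = 1 → 𝔭.asIdeal.inertiaDeg (𝓞 ℚ) = 1 →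
          ∀ (f : CuspForm (CongruenceSubgroup.Gamma0 (W.conductorNorm ℤ)) 2), IsNewformOf W f →
            ∀ (ι' : PadicAlgCl p ≃+* ℂ),
              (∀ (w : InfinitePlace K) (k : 𝓞 K), k ∈ 𝔭.asIdeal ↔ ‖ι'.symm (w.embedding (k : K))‖ < 1) →
              ∀ (A : ℝ) (ΩK C : ℂ) (Ωp : (unrIntegers p)ˣ) (QH : PowerSeries (PadicComplexInt p)),
                0 < A → ΩK ≠ 0 → ‖((ι'.symm C : PadicAlgCl p) : ℂ_[p])‖ = 1 →
                IsHsiehLFunction ι' 𝔭 κ γ f A ΩK C ((Ωp : unrIntegers p) : ℂ_[p]) QH →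
                  ∀ (𝔭' : HeightOneSpectrum (𝓞 K)), ((p : ℕ) : 𝓞 K) ∈ 𝔭'.asIdeal → 𝔭' ≠ 𝔭 →
                  Module.IsTorsion (IwasawaAlgebra p) (XAc (W.baseChange K) p κ 𝔭' ∅ γ) →
                  ∃ m : ℕ, ∀ x ∈ (XAc.charIdeal (W.baseChange K) p κ 𝔭' ∅ γ).map
                      (PowerSeries.map (R1.toCpInt p)),
                    (PowerSeries.C ((p : ℕ) : PadicComplexInt p) : PowerSeries (PadicComplexInt p)) ^ m * x ∈
                      Ideal.span {QH}) :
    HeartA := by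
  intro hThmA W _ _ p _ _ K _ _ hCM _hr hp5 hin hbad hK hHN hd4 hh _hLt κ hκ γ _ 𝔭 h𝔭 he hf1 f hf ι' hι ΩK Ωp Q
    hΩK hQ 𝔭' h𝔭' hne htors
  have hp : p.Prime := Fact.out
  have hp2 : p ≠ 2 := by omega
  have hpN : p ∣ W.conductorNorm ℤ := (W.dvd_conductorNorm_iff_not_hasGoodReductionAtPrime p).mpr hbad
  have hγ : κ.IsTopGenerator γ := Fact.out
  obtain ⟨A, ΩK₁, C, Ωp₁, QH, hA, hΩK₁, hC, hQH⟩ :=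
    Summit.BirchSwinnertonDyer.BirchSwinnertonDyer.Theorems.BiquadraticEisensteinDescentEisensteinHeartFlatCMInertBadKPrimeHsiehWitness.stub_hsiehWitness_of_thmA
      hThmA W p K hp5 hbad hK hHN κ hκ γ 𝔭 h𝔭 f hf ι' hι
  obtain ⟨m, hm⟩ := hdiv W p K hCM hp5 hin hbad hK hHN hd4 hh κ hκ γ 𝔭 h𝔭 he hf1 f hf ι' hι A ΩK₁ C Ωp₁ QH hA
    hΩK₁ hC hQH 𝔭' h𝔭' hne htors
  have hΩp₁ : ((Ωp₁ : unrIntegers p) : ℂ_[p]) ≠ 0 := by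
    rw [Ne, ZeroMemClass.coe_eq_zero]; exact Ωp₁.ne_zero
  have hΩp : ((Ωp : unrIntegers p) : ℂ_[p]) ≠ 0 := by
    rw [Ne, ZeroMemClass.coe_eq_zero]; exact Ωp.ne_zero
  have hideal : Ideal.span ({QH} : Set (PowerSeries (PadicComplexInt p))) = Ideal.span {Q} :=
    span_singleton_eq_of_isHsiehLFunction_of_isBDPLFunctionInt hp2 hK hκ hγ hpN hA hΩK₁ hC hΩp₁ hQH hΩK hΩp hQ
  exact ⟨m, fun x hx ↦ by rw [← hideal]; exact hm x hx⟩

end Summit.BirchSwinnertonDyer.BirchSwinnertonDyer.Cruxes.EisensteinHeartFlatCMInertBadKPrime.ThreadA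

end
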